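import Literature.AlgebraicGeometry.Frobenioids.PrimesEquivPreStep
import Literature.AlgebraicGeometry.Frobenioids.PrimesEquivFrobeniusType
import Literature.AlgebraicGeometry.Frobenioids.Composites
import HarnessLib

/-!
# Frobenioids I, Theorem 4.2 (ii): functoriality of `Ψ^Prime` on `C^{bs-iso}` (all base-isomorphisms)

Mochizuki, *The geometry of Frobenioids I: the general theory*, Kyushu J. Math. **62** (2008)
293–400, §4, Theorem 4.2 (ii), kurims text p. 80 ll. 44–45 [cite: MochizukiFrdI2008, Thm. 4.2 (ii) p.80]:
"To check the functoriality of `Ψ^Prime(−)` with respect to arbitrary base-isomorphisms, it suffices to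
check it with respect to morphisms of Frobenius type and pre-steps [cf. Proposition 1.7, (ii)]."

PROOF-ONLY assembly (seat abc-iut-w4-d090) of the two cases — morphisms of Frobenius type
(abc-iut-L1-t2, `primesEquiv_naturality_frobeniusType_mem`, sub-node `T42-L09`) and pre-steps
(`primesEquiv_naturality_preStep_mem`, sub-node `T42-L10`) — along the factorization "base-isomorphism =
(pre-step) ∘ (Frobenius type)" of Prop. 1.7 (ii) (`isBaseIso_iff_exists_frobeniusType_preStep`): for EVERY
base-isomorphism `γ : A → A'`, primes corresponding under `Φ₁(Base γ)` are carried by the family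
`e = Ψ^Prime` to primes corresponding under `Φ₂(Base (Ψ γ))` (`primesEquiv_naturality_baseIso_mem`).
Hypotheses BY NAME as in `PrimaryStepsTransport.lean` (Thm. 3.4 (ii)/(iii): `Ψ`, `Ψ⁻¹` preserve pre-steps,
`Ψ` preserves morphisms of Frobenius type; Thm. 4.2 (i): `Ψ` preserves primary pre-steps).
No new definitions; no statement of the paper is strengthened.
-/

namespace Literature.AlgebraicGeometry.Frobenioids

open CategoryTheory Opposite

namespace PreFrobenioid

universe w v v' u u' w₂ v₂ v₂' u₂ u₂'

variable {D : Type u} [Category.{v} D] {Φ : Dᵒᵖ ⥤ CommMonCat.{w}}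
  {C : Type u'} [Category.{v'} C] {F : C ⥤ ElemFrobenioid Φ}
  {D₂ : Type u₂} [Category.{v₂} D₂] {Φ₂ : D₂ᵒᵖ ⥤ CommMonCat.{w₂}}
  {C₂ : Type u₂'} [Category.{v₂'} C₂] {F₂ : C₂ ⥤ ElemFrobenioid Φ₂} (Ψ : C ≌ C₂)

set_option backward.isDefEq.respectTransparency false in
/-- **Theorem 4.2 (ii), functoriality of `Ψ^Prime` on `C^{bs-iso}`** ("To check the functoriality of
`Ψ^Prime(−)` with respect to arbitrary base-isomorphisms, it suffices to check it with respect to morphisms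
of Frobenius type and pre-steps [cf. Proposition 1.7, (ii)]", FrdI p. 80 ll. 44–45): under the hypotheses
of the two cases (`Ψ`, `Ψ⁻¹` preserve pre-steps; `Ψ` preserves morphisms of Frobenius type and primary
pre-steps), for EVERY base-isomorphism `γ : A → A'`, primes corresponding under `Φ₁(Base γ)` are carried by
`e` to primes corresponding under `Φ₂(Base (Ψ γ))`. [cite: MochizukiFrdI2008, Thm. 4.2 (ii) p.80] -/
theorem primesEquiv_naturality_baseIso_mem (hF : IsFrobenioid F) (hF₂ : IsFrobenioid F₂)
    (hperf : IsOfPerfectType F) (hperf₂ : IsOfPerfectType F₂) (histr : IsOfIsotropicType F)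
    (histr₂ : IsOfIsotropicType F₂) (hpf : Objectwise (fun M _ => IsPerfFactorial M) Φ)
    (hpf₂ : Objectwise (fun M _ => IsPerfFactorial M) Φ₂)
    (hpre : ∀ ⦃X Y : C⦄ (φ : X ⟶ Y), IsPreStep F φ → IsPreStep F₂ (Ψ.functor.map φ))
    (hpre' : ∀ ⦃X Y : C₂⦄ (φ : X ⟶ Y), IsPreStep F₂ φ → IsPreStep F (Ψ.inverse.map φ))
    (hfrob : ∀ ⦃X Y : C⦄ (φ : X ⟶ Y), IsFrobeniusType F φ → IsFrobeniusType F₂ (Ψ.functor.map φ))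
    (hprim : ∀ ⦃X Y : C⦄ (φ : X ⟶ Y), IsPrimaryPreStep F φ → IsPrimaryPreStep F₂ (Ψ.functor.map φ))
    (e : ∀ A : C, Primes (Φ.obj (op (baseObj F A))) ≃ Primes (Φ₂.obj (op (baseObj F₂ (Ψ.functor.obj A)))))
    (he : ∀ (A : C) ⦃E : C⦄ (ε : E ⟶ A) (hε : IsPrimaryPreStep F ε) (𝔭 : Primes (Φ.obj (op (baseObj F A)))),
      invDiv F ε hε.1.2 ∈ 𝔭.carrier → ∀ h₂ : IsBaseIso F₂ (Ψ.functor.map ε),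
        invDiv F₂ (Ψ.functor.map ε) h₂ ∈ (e A 𝔭).carrier)
    {A A' : C} (γ : A ⟶ A') (hγ : IsBaseIso F γ)
    (𝔭 : Primes (Φ.obj (op (baseObj F A)))) (𝔭' : Primes (Φ.obj (op (baseObj F A'))))
    (hrel : ∃ p' ∈ 𝔭'.carrier, pull Φ (Base F γ) p' ∈ 𝔭.carrier) :
    ∃ q' ∈ (e A' 𝔭').carrier, pull Φ₂ (Base F₂ (Ψ.functor.map γ)) q' ∈ (e A 𝔭).carrier := by
  obtain ⟨p', hp', hpp'⟩ := hrel
  -- `γ = β ≫ α` with `β` of Frobenius type and `α` a pre-step (Prop. 1.7 (ii))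
  obtain ⟨X, β, α, hfac, hβ, hα⟩ := (isBaseIso_iff_exists_frobeniusType_preStep F hF γ).mp hγ
  haveI : IsIso (Base F α) := hα.2
  haveI : IsIso (Base F β) := hβ.2
  -- the intermediate prime `𝔭_X ∋ Φ(Base α)(p')`
  have hpXprim : IsPrimary (pull Φ (Base F α) p') := (isPrimary_pull_iff (Base F α) p').mpr hp'.1
  let 𝔭X : Primes (Φ.obj (op (baseObj F X))) := Quotient.mk _ ⟨pull Φ (Base F α) p', hpXprim⟩
  have hpX : pull Φ (Base F α) p' ∈ 𝔭X.carrier := mem_carrier_mk_of_isPrimary hpXprim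
  have hppX : pull Φ (Base F β) (pull Φ (Base F α) p') ∈ 𝔭.carrier := by
    rw [← pull_comp, ← base_comp, hfac]
    exact hpp'
  -- the pre-step case along `α`, the Frobenius-type case along `β`
  obtain ⟨q', hq', hq'X⟩ := primesEquiv_naturality_preStep_mem Ψ hF hF₂ hperf hperf₂ histr histr₂ hpf hpf₂
    hpre hpre' e he α hα 𝔭X 𝔭' ⟨p', hp', hpX⟩
  obtain ⟨y, hy, hyA⟩ := primesEquiv_naturality_frobeniusType_mem Ψ.functor hF hF₂ hfrob
    (fun E ε hε => hprim ε hε) (fun E ε hε => hprim ε hε) (e X) (e A)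
    (fun E ε hε 𝔮 h => he X ε hε 𝔮 h (hprim ε hε).1.2) (fun E ε hε 𝔮 h => he A ε hε 𝔮 h (hprim ε hε).1.2)
    β hβ 𝔭X 𝔭 ⟨pull Φ (Base F α) p', hpX, hppX⟩
  -- compose along `Ψ γ = Ψ β ≫ Ψ α`
  refine ⟨q', hq', ?_⟩
  haveI : IsIso (Base F₂ (Ψ.functor.map β)) := (hfrob β hβ).2
  obtain ⟨eβ, heβ⟩ := exists_mulEquiv_pull (Φ := Φ₂) (Base F₂ (Ψ.functor.map β))
  rw [← hfac, Functor.map_comp, base_comp, pull_comp, ← heβ]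
  exact Primes.map_mem_carrier_of_mem eβ hy (by rw [heβ]; exact hyA) hq'X

end PreFrobenioid

end Literature.AlgebraicGeometry.Frobenioids
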